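/-
Copyright: statement-level skeleton of a published paper (lit-balaban cell, Phase-2 proof seat p25, gen 17). No proof
claims beyond what the kernel checks below.
-/
import Literature.MathematicalPhysics.QuantumFieldTheory.BalabanImbrieJaffe1984to88.BIJ88BracketDecay311
import Literature.MathematicalPhysics.QuantumFieldTheory.BalabanImbrieJaffe1984to88.BIJ88SlotFieldGaussBounds

/-!
# `BalabanImbrieJaffe1984to88.BIJ88LawBracketDecay312` — T. Bałaban, J. Imbrie, A. Jaffe, *Effective action and cluster
properties of the abelian Higgs model*, Commun. Math. Phys. **114** (1988) 257–315 [BalabanImbrieJaffe1988], §5.14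
p. 311 [PDF 55]: *"those fields can be contracted via covariances C^{(k)}_{Λ(k)} or C^{(k)}_{Λ(k)}(u_{k+1}) to other
observables, to χ′_{Λ(k)}, or to the interaction."* — **THE COVARIANCE OF THE LAW OF THE FIELDS OF A REGION `W` DECAYS,
AND SO DO ALL BLOCKS AND REMAINDER COMPONENTS OF THE LABELLED EXPANSION ON THE MODEL OF RECORD.**  The sibling
`BIJ88BracketDecay311` (p25 gen 17) discharges the bracket-decay hypothesis of `BIJ88LabelledDiamDecay312` for an abstract
banded coercive precision.  Here it is put on the §5.13 model of record: the law `fieldLaw blk Δ ℱ W` of the fields on the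
sites of `W` has precision `prec blk Δ W 1_W = Δ|_W` (`BIJ88PolymerRep5134Gauss.prec_ind_self`,
`BIJ88SlotFieldGaussBounds.prec_corner_self_apply`), and `Δ|_W` INHERITS from `Δ` — sites `α` carrying a pseudo-distance —
bandedness (`prec_banded`), the off-diagonal bound (`prec_offdiag`), the neighbour count (`prec_neighbours`) and coercivity
(`BIJ88SlotFieldGaussBounds.dotProduct_prec_mulVec_ge`, p36).  Hence, by the tree's Combes–Thomas estimate
[CombesThomas1973]: `|(Δ|_W)⁻¹ x y| ≤ (2/σ) e^{−μ dist x y}` UNIFORMLY IN THE REGION `W` (`inv_prec_entry_decay`), the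
brackets of `r₁`-localized `ℓ¹`-bounded legs decay (`prec_bracket_decay`, `prec_bracket_source_le`), and every block `X_c` and
remainder component `X_r` of every term of `expand (Δ|_W) (ℱ|_W) …` carries `e^{−μ·diam(cubes X)}` with constants depending
on `(σ, h, z, μ, r₀, r₁, L₁, ‖ℱ|_W‖₁)` only (`expand_decay_bound_law`).

statement-level skeleton of published theorems with citation tags; proofs where landed; nothing here is a claim
about the Yang–Mills mass gap

PDF held: `paper:balaban1988-cmp114-bij-abelian-higgs-effective-action` (journal page = PDF page + 256); p. 311 = PDF 55
(`p0055.txt` L25–27 re-read this session; the quoted sentence is verbatim there up to the OCR of sub/superscripts).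

CITATION HEADER (lean-in-tree rule).  lit-balaban cell (HOME `run/shared/lean/pub/lit-balaban/`), Phase 2, seat p25
gen 17; row **C2.Claim@312** of `HOME/lit-balaban-r16/ROWS-C2-part2.md` (owner r16, referee ref-5; head
`BIJ88Sect5StatementsPart4.Ineq312` NOT touched — a MEMBER on the model of record).  USED BY NAME, nothing restated:
`BIJ88BracketDecay311` (`inv_entry_decay`, `bracket_decay`, `bracket_source_le`, `expand_decay_bound_banded`; p25),
`BIJ88SlotFieldGaussBounds` (`prec_corner_self_apply`, `dotProduct_prec_mulVec_ge`; p36), `BIJ88PolymerRep5134Gauss`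
(`prec`, `src`), `BIJ88PolymerRep5134.corner`, `Literature.Analysis.OperatorTheory.combesThomas_banded` ([CombesThomas1973],
through the sibling), `BIJ88LabelledExpansion311.expand`, `BIJ88ComponentCubes311.cubes`.

## What is proved (0 `sorry`, standard axioms, no definitions, no `Prop` facts)

* §1 `prec_banded`, `prec_offdiag`, `prec_neighbours` (the `W`-block inherits the banded structure of `Δ`).
* §2 **`inv_prec_entry_decay`**, **`prec_bracket_decay`**, `prec_bracket_source_le`, **`expand_decay_bound_law`**.
HONEST SCOPE: as in `BIJ88BracketDecay311` — the elementary finite-range coercive model for `Δ` (e.g. `−Δ_lattice + m²`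
with unit cubes), `μ` limited by `h z (e^μ − 1) ≤ σ/2`; NOT Bałaban's multi-scale propagators `C^{(k)}` and their estimates
(refs. 3–5 of the paper); diameter decay, not connectedness / tree decay (no `C_loc` split).  CURRENCY: feeds none of
`BIJ88Sect5StatementsPart4.Ineq312` / `hobs` / `RemainderComponent` by name, instantiates none of `Ineq312`'s binders.
NOT summit progress; NOT continuum; NOT Clay.  Imports `BIJ88BracketDecay311`, `BIJ88SlotFieldGaussBounds`; modifies
nothing.
-/

noncomputable section

namespace Literature.MathematicalPhysics.QuantumFieldTheory.BalabanImbrieJaffe1984to88.BIJ88LawBracketDecay312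

open Classical Matrix Finset
open scoped BigOperators
open BIJ88PolymerRep5134 (corner)
open BIJ88PolymerRep5134Gauss (prec src)
open BIJ88SlotFieldGaussBounds (prec_corner_self_apply dotProduct_prec_mulVec_ge)
open BIJ88VertexComponents311 (Grp maxArity)
open BIJ88LabelledRun311 BIJ88LabelledExpansion311 BIJ88ComponentCubes311 BIJ88LabelledDiamDecay312 BIJ88BracketDecay311

variable {α I : Type} [Fintype α] [DecidableEq α] [Fintype I] [DecidableEq I] [PseudoMetricSpace α]
  (blk : α → I) (Δ : Matrix α α ℝ) (ℱ : α → ℝ) (W : Finset I)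

/-! ## §1  The `W`-block `Δ|_W` inherits the banded structure of `Δ` -/

section Inherit

/-- `Δ` banded (`Δ_{xy} = 0` for `dist x y > 1`) ⇒ `Δ|_W` banded, for the induced distance on the sites of `W`.
[cite: BalabanImbrieJaffe1988, §5.13 p.305] -/
theorem prec_banded (hband : ∀ x y : α, 1 < dist x y → Δ x y = 0) :
    ∀ x y : {x : α // blk x ∈ W}, 1 < dist x y → prec blk Δ W (corner ℝ W) x y = 0 := by
  intro x y h
  rw [prec_corner_self_apply]
  exact hband _ _ (by rwa [Subtype.dist_eq] at h)

omit [PseudoMetricSpace α] in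
/-- the off-diagonal bound descends: `|Δ_{xy}| ≤ h` (`x ≠ y`) ⇒ `|(Δ|_W)_{xy}| ≤ h`. [cite: BalabanImbrieJaffe1988, §5.13 p.305] -/
theorem prec_offdiag {h : ℝ} (hh : ∀ x y : α, x ≠ y → |Δ x y| ≤ h) :
    ∀ x y : {x : α // blk x ∈ W}, x ≠ y → |prec blk Δ W (corner ℝ W) x y| ≤ h := by
  intro x y hne
  rw [prec_corner_self_apply]
  exact hh _ _ fun e => hne (Subtype.ext e)

omit [Fintype I] in
/-- the neighbour count descends: at most `z` sites within distance `1` of any site ⇒ the same inside `W`.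
[cite: BalabanImbrieJaffe1988, §5.13 p.305] -/
theorem prec_neighbours {z : ℝ} (hz : ∀ x : α, ((univ.filter fun k => k ≠ x ∧ dist x k ≤ 1).card : ℝ) ≤ z) :
    ∀ x : {x : α // blk x ∈ W}, ((univ.filter fun k : {x : α // blk x ∈ W} => k ≠ x ∧ dist x k ≤ 1).card : ℝ) ≤ z := by
  intro x
  refine le_trans ?_ (hz x.1)
  have hsub : (univ.filter fun k : {x : α // blk x ∈ W} => k ≠ x ∧ dist x k ≤ 1).card
      ≤ (univ.filter fun k : α => k ≠ x.1 ∧ dist x.1 k ≤ 1).card := by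
    refine Finset.card_le_card_of_injOn Subtype.val ?_ (Set.injOn_of_injective Subtype.val_injective)
    intro k hk
    simp only [Finset.coe_filter, Finset.mem_univ, true_and, Set.mem_setOf_eq] at hk ⊢
    exact ⟨fun e => hk.1 (Subtype.ext e), by rw [← Subtype.dist_eq]; exact hk.2⟩
  exact_mod_cast hsub

end Inherit

/-! ## §2  Combes–Thomas decay for the law of the fields of `W`, and the diameter decay on the model of record -/

section Decay

variable {σ h z μ : ℝ}

/-- **THE COVARIANCE OF THE LAW OF THE FIELDS OF `W` DECAYS, UNIFORMLY IN `W`**: for `Δ` banded, off-diagonal `≤ h`, at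
most `z` neighbours, coercive `⟨ω, Δω⟩ ≥ σ‖ω‖²`, and `h z (e^μ − 1) ≤ σ/2`:
`|(Δ|_W)⁻¹ x y| ≤ (2/σ) e^{−μ dist x y}` for all sites `x, y` of `W`. [cite: CombesThomas1973, §II]
[cite: BalabanImbrieJaffe1988, §5.14 p.311] -/
theorem inv_prec_entry_decay (hσ : 0 < σ) (hμ : 0 ≤ μ) (hband : ∀ x y : α, 1 < dist x y → Δ x y = 0) (hh0 : 0 ≤ h)
    (hh : ∀ x y : α, x ≠ y → |Δ x y| ≤ h) (hz : ∀ x : α, ((univ.filter fun k => k ≠ x ∧ dist x k ≤ 1).card : ℝ) ≤ z)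
    (hpos : ∀ ω : α → ℝ, σ * (ω ⬝ᵥ ω) ≤ ω ⬝ᵥ Δ *ᵥ ω) (hsmall : h * z * (Real.exp μ - 1) ≤ σ / 2)
    (x y : {x : α // blk x ∈ W}) :
    |(prec blk Δ W (corner ℝ W))⁻¹ x y| ≤ 2 / σ * Real.exp (-(μ * dist x.1 y.1)) :=
  inv_entry_decay hσ hμ (prec_banded blk Δ W hband) hh0 (prec_offdiag blk Δ W hh) (prec_neighbours blk W hz)
    (dotProduct_prec_mulVec_ge blk Δ W hpos) hsmall x y

/-- **the brackets of the law decay**: for legs `u, v ∈ Dir` on the sites of `W`, each supported within `r₁` of its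
location and of `ℓ¹`-norm `≤ L₁`, `|⟨(Δ|_W)⁻¹u, v⟩| ≤ (2/σ)·e^{2μr₁}·L₁²·e^{−μ·dist(loc u, loc v)}`.
[cite: CombesThomas1973, §II] [cite: BalabanImbrieJaffe1988, §5.14 p.311] -/
theorem prec_bracket_decay (hσ : 0 < σ) (hμ : 0 ≤ μ) (hband : ∀ x y : α, 1 < dist x y → Δ x y = 0) (hh0 : 0 ≤ h)
    (hh : ∀ x y : α, x ≠ y → |Δ x y| ≤ h) (hz : ∀ x : α, ((univ.filter fun k => k ≠ x ∧ dist x k ≤ 1).card : ℝ) ≤ z)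
    (hpos : ∀ ω : α → ℝ, σ * (ω ⬝ᵥ ω) ≤ ω ⬝ᵥ Δ *ᵥ ω) (hsmall : h * z * (Real.exp μ - 1) ≤ σ / 2)
    {Dir : Set ({x : α // blk x ∈ W} → ℝ)} (loc : ({x : α // blk x ∈ W} → ℝ) → {x : α // blk x ∈ W}) {r₁ L₁ : ℝ}
    (hL : 0 ≤ L₁) (hsupp : ∀ w ∈ Dir, ∀ x, w x ≠ 0 → dist x (loc w) ≤ r₁) (hl1 : ∀ w ∈ Dir, ∑ x, |w x| ≤ L₁) :
    ∀ u ∈ Dir, ∀ v ∈ Dir, |((prec blk Δ W (corner ℝ W))⁻¹ *ᵥ u) ⬝ᵥ v|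
      ≤ 2 / σ * Real.exp (2 * μ * r₁) * L₁ ^ 2 * Real.exp (-(μ * dist (loc u) (loc v))) :=
  bracket_decay hσ hμ (prec_banded blk Δ W hband) hh0 (prec_offdiag blk Δ W hh) (prec_neighbours blk W hz)
    (dotProduct_prec_mulVec_ge blk Δ W hpos) hsmall loc hL hsupp hl1

/-- the source brackets of the law are bounded: `|⟨(Δ|_W)⁻¹u, ℱ|_W⟩| ≤ (2/σ)·L₁·‖ℱ|_W‖₁` for `u ∈ Dir`.
[cite: CombesThomas1973, §II] [cite: BalabanImbrieJaffe1988, §5.14 p.311] -/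
theorem prec_bracket_source_le (hσ : 0 < σ) (hμ : 0 ≤ μ) (hband : ∀ x y : α, 1 < dist x y → Δ x y = 0) (hh0 : 0 ≤ h)
    (hh : ∀ x y : α, x ≠ y → |Δ x y| ≤ h) (hz : ∀ x : α, ((univ.filter fun k => k ≠ x ∧ dist x k ≤ 1).card : ℝ) ≤ z)
    (hpos : ∀ ω : α → ℝ, σ * (ω ⬝ᵥ ω) ≤ ω ⬝ᵥ Δ *ᵥ ω) (hsmall : h * z * (Real.exp μ - 1) ≤ σ / 2)
    {Dir : Set ({x : α // blk x ∈ W} → ℝ)} {L₁ : ℝ} (hl1 : ∀ w ∈ Dir, ∑ x, |w x| ≤ L₁) :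
    ∀ u ∈ Dir, |((prec blk Δ W (corner ℝ W))⁻¹ *ᵥ u) ⬝ᵥ src blk ℱ W| ≤ 2 / σ * L₁ * ∑ x : {x : α // blk x ∈ W}, |ℱ x.1| :=
  bracket_source_le hσ hμ (prec_banded blk Δ W hband) hh0 (prec_offdiag blk Δ W hh) (prec_neighbours blk W hz)
    (dotProduct_prec_mulVec_ge blk Δ W hpos) hsmall hl1 (src blk ℱ W)

variable {ι : Type} [Fintype ι] {κ : Type} [LinearOrder κ]

/-- **EVERY BLOCK AND EVERY REMAINDER COMPONENT OF THE LABELLED EXPANSION ON THE MODEL OF RECORD CARRIES `e^{−μ·diam}`**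
(`BIJ88BracketDecay311.expand_decay_bound_banded` for the precision `Δ|_W` and source `ℱ|_W` of the law of the fields
of `W`, hypotheses on `Δ` only): with `B := max((2/σ)e^{2μr₁}L₁², (2/σ)L₁‖ℱ|_W‖₁)`, for every `t ∈ expand (Δ|_W) (ℱ|_W) … 0 K`,
`|coef_t| · exp(μ·Σ_{X ∈ X_c's, X_r's of t} diam(cubes X)) ≤ (max B 1)^{Φ₀(K)} · e^{μ r₀ |K|} · (c_M e^{μ r₀})^{nv_t}`.
[cite: BalabanImbrieJaffe1988, §5.14 p.311–312] -/
theorem expand_decay_bound_law (hσ : 0 < σ) (hμ : 0 ≤ μ) (hband : ∀ x y : α, 1 < dist x y → Δ x y = 0) (hh0 : 0 ≤ h)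
    (hh : ∀ x y : α, x ≠ y → |Δ x y| ≤ h) (hz : ∀ x : α, ((univ.filter fun k => k ≠ x ∧ dist x k ≤ 1).card : ℝ) ≤ z)
    (hpos : ∀ ω : α → ℝ, σ * (ω ⬝ᵥ ω) ≤ ω ⬝ᵥ Δ *ᵥ ω) (hsmall : h * z * (Real.exp μ - 1) ≤ σ / 2)
    {c : ι → ℝ} {legs : ι → List ({x : α // blk x ∈ W} → ℝ)} {obs : κ → List ({x : α // blk x ∈ W} → ℝ)} {M : ℕ}
    {Dir : Set ({x : α // blk x ∈ W} → ℝ)} {loc : ({x : α // blk x ∈ W} → ℝ) → {x : α // blk x ∈ W}}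
    {cM r₀ r₁ L₁ : ℝ} (hL : 0 ≤ L₁) (hsupp : ∀ w ∈ Dir, ∀ x, w x ≠ 0 → dist x (loc w) ≤ r₁)
    (hl1 : ∀ w ∈ Dir, ∑ x, |w x| ≤ L₁) (hr : 0 ≤ r₀) (hcM : 0 ≤ cM) (hcm : ∀ m, |c m| ≤ cM)
    (hobs : ∀ j, ∀ w ∈ obs j, w ∈ Dir) (hlegs : ∀ m, ∀ w ∈ legs m, w ∈ Dir)
    (hro : ∀ j, ∀ w ∈ obs j, ∀ w' ∈ obs j, dist (loc w) (loc w') ≤ r₀)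
    (hrv : ∀ m, ∀ w ∈ legs m, ∀ w' ∈ legs m, dist (loc w) (loc w') ≤ r₀) (K : Finset κ) :
    ∀ t ∈ expand (prec blk Δ W (corner ℝ W)) (src blk ℱ W) c legs obs M 0 K,
      |t.coef| * Real.exp (μ * ((t.consts + t.groups).map fun g => Metric.diam (cubes loc obs g)).sum)
        ≤ (max (max (2 / σ * Real.exp (2 * μ * r₁) * L₁ ^ 2) (2 / σ * L₁ * ∑ x : {x : α // blk x ∈ W}, |ℱ x.1|)) 1)
            ^ (∑ j ∈ K, ((obs j).length + 1 + M * maxArity legs)) * Real.exp (μ * (r₀ * K.card))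
          * (cM * Real.exp (μ * r₀)) ^ t.nv :=
  expand_decay_bound_banded hσ hμ (prec_banded blk Δ W hband) hh0 (prec_offdiag blk Δ W hh) (prec_neighbours blk W hz)
    (dotProduct_prec_mulVec_ge blk Δ W hpos) hsmall hL hsupp hl1 hr hcM hcm hobs hlegs hro hrv K

end Decay

end Literature.MathematicalPhysics.QuantumFieldTheory.BalabanImbrieJaffe1984to88.BIJ88LawBracketDecay312

end
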